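import Literature.Barriers.CriticalPhenomena.LaceExpansionIsingDeconvolution
import Mathlib.Analysis.SpecificLimits.Basic
import Literature.Probability.LatticeModels.LatticeGreenFunction
import Literature.Probability.Percolation.InfraredTriangleAnalysis
import HarnessLib

/-!
# The random-walk bound `G_β ≤ S_τ` (`τ = N_L tanh β ≤ 1`) for the spread-out Ising model:
# the named fact `spreadOutTwoPoint_le_soGreen` proved, via the transience of the walk (proved)

Barrier catalogue `Literature/Barriers/CriticalPhenomena/` (D-0021), fourth file of the barrier
`LaceExpansionIsingAboveFour`; companion of `LaceExpansionIsingDeconvolution.lean`, which reduces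
Sakai's Theorem 1.3 (spread-out) to named facts among which clause (iv) of Liu–Slade's
Assumption 1.3, the random-walk bound `spreadOutTwoPoint_le_soGreen`
(`G_β(x) ≤ S_τ(x)` for `τ = N_L tanh β ≤ 1`, Sakai 2007, §4.1, footnote to (4.2): "Repeated
applications of (4.2) to the translation-invariant models result in the random-walk bound:
`⟨φ_oφ_x⟩_Λ ≤ S_τ(x)` for `Λ ⊂ ℤ^d` and `τ ≤ 1`").

This file PROVES that bound along the printed route, including its one classical input, the
transience of the spread-out walk in `d > 2` (named fact `soWalk_transient`, DISCHARGED below by a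
Fourier argument: `soWalk_transient_holds`), which enters only at `τ = 1`:

* finite volume (`isingTwoPoint_le_delta_add`, Sakai's (4.2) = the modified Simon inequality of
  the tree with `S = {a}`: `⟨σ_aσ_x⟩_Λ ≤ δ_{a,x} + tanh β Σ_{y ∈ Λ, y ∼ a} ⟨σ_yσ_x⟩_Λ`), iterated
  `n` times with the averaging identity `Σ_{y ∼ a} D^{*k}(x - y) D(y - a) = D^{*(k+1)}(x - a)`
  (`isingTwoPoint_le_sum_convPow_add_pow`: `⟨σ_aσ_x⟩_Λ ≤ Σ_{k<n} τᵏD^{*k}(x - a) + τⁿ`, the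
  remainder bounded by `τⁿ` because finite-volume two-point functions are at most `1`);
* `τ < 1`: `n → ∞` and the supremum over boxes (`spreadOutTwoPoint_le_soGreen_of_lt_one`, no
  transience needed, the series being dominated by `Σ τⁿ`);
* `τ = 1`: `G_β(x) = sup_{β' < β} G_{β'}(x)` (lower semicontinuity of the monotone volume limit,
  `spreadOutTwoPoint_le_of_forall_lt`) and `S_{τ'} ≤ S_1` termwise, which is where the convergence
  of `S_1` is used (`spreadOutTwoPoint_le_soGreen_of_summable`,
  `spreadOutTwoPoint_le_soGreen_of_transient`);
* transience (section `Transience`): the symbol `D̂(k) = Σ_x D(x)cos(k·x)` (`soSymbol`), the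
  orthogonality `∫_{[-π,π]^d} cos(k·x)dk = (2π)^d 1{x=0}` (`integral_cube_cos_kdot`, from the tree's
  `integral_cexp_neg_kdot` of `InfraredTriangleAnalysis.lean`), the Fourier representation
  `D^{*n}(x) = (2π)^{-d}∫ D̂ⁿ cos(k·x) dk` (`convPow_eq_integral`), the infrared bound
  `1 - D̂(k) ≥ (2/N_L) Σ_j(1 - cos k_j)` from the unit steps `±e_j`
  (`mul_dispersion_le_one_sub_soSymbol`), `|Σ_{n<M} D̂ⁿ| ≤ 2/(1 - D̂)`, and the integrability of
  `1/ε` on the Brillouin zone in `d ≥ 3` (the tree's `integrable_indicator_inv_dispersion`) give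
  uniformly bounded partial sums, hence `summable_convPow`;
* consequently `soWalk_transient_holds`, `spreadOutTwoPoint_le_soGreen_holds`,
  `lsAssumptionG_isingFamily_holds` (Liu–Slade's Assumption 1.3 for the Ising model,
  unconditionally) and `Sakai2007_thm13_spreadOut_of_three_facts`: Sakai's Theorem 1.3
  (spread-out) from THREE named facts — Liu–Slade's Prop. 1.2 and Thm. 1.7 (pure analysis) and
  Sakai's lace expansion with diagrammatic bounds (`Sakai2007_isingAssumptionH`); and the barrier
  itself from five named facts, `LaceExpansionIsingAboveFour_of_five_facts` (those three and
  Aizenman's bubble bound for the two models);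
* the same assemblies re-threaded through the CORRECTED transcription `LiuSlade2026_thm1_7` of
  Liu–Slade's Theorem 1.7 (`LaceExpansionIsingDeconvolution.lean`, Part G: `LiuSlade2026_thm17`
  is misstated — its `λ`-clause quantifies a fresh `ε'` — and superseded):
  `Sakai2007_thm13_spreadOut_of_thm1_7''`, `Sakai2007_thm13_spreadOut_of_three_facts'`,
  `LaceExpansionIsingAboveFour_of_five_facts'`. These primed versions are the live trust base.

Also: the elementary API of the convolution powers `D^{*n}` of the step distribution
(`0 ≤ D^{*n} ≤ 1`, the finite-sum formula `D^{*(n+1)}(w) = Σ_{u ∼ w} D^{*n}(u)D(w - u)`,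
convergence of `S_μ` for `0 ≤ μ < 1`).

## References

* A. Sakai, *Lace expansion for the Ising model*, Comm. Math. Phys. 272 (2007) 283–344,
  arXiv:math-ph/0510093: §1.2, (1.19) (`S_r = Σ_i rⁱD^{*i}`; "The leading asymptotics of `S_1(x)`
  for `d > 2` is known"), §4.1, (4.2) and its footnote (the random-walk bound) [Sakai2007].
* Y. Liu, G. Slade, arXiv:2310.07640, §1.1 (1.4) (Fourier transform and inversion on `ℤ^d`),
  §1.2.1, (1.6)–(1.8) (`S_μ`, `d > 2`) and Assumption 1.3 (iv) [LiuSlade2026].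
* M. Aizenman, H. Duminil-Copin, V. Sidoravicius, CMP 334 (2015), arXiv v3 (1.18) (`∫dp/E(p) < ∞`
  for `d > 2`; the tree's `integrable_indicator_inv_dispersion`)
  [AizenmanDuminilCopinSidoraviciusCMP2015].
* H. Duminil-Copin, V. Tassion, arXiv:1502.03050, Lemma 2.7 (modified Simon inequality)
  [DuminilCopinTassionCMP2016].
(Equation numbers are those of the arXiv versions held in the literature store.)
-/

noncomputable section

namespace Literature.Barriers.CriticalPhenomena.SpreadOutIsing

open MeasureTheory Filter Topology Finset Literature.Probability.LatticeModels
open scoped ENNReal BigOperators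

variable {d L : ℕ}

/-! ### Convolution powers of the step distribution -/

/-- `D(y - a) = N_L⁻¹ 1{a ∼ y}`. [folklore] -/
theorem soStep_sub (a y : Site d) :
    soStep d L (y - a) = if (spreadOutGraph d L).Adj a y then ((soCount d L : ℝ))⁻¹ else 0 := by
  unfold soStep
  exact if_congr (spreadOutGraph_adj_iff_sub d L a y).symm rfl rfl

/-- `D^{*n} ≥ 0`. [folklore] -/
theorem convPow_nonneg (n : ℕ) (x : Site d) : 0 ≤ convPow (soStep d L) n x := by
  induction n generalizing x with
  | zero => exact delta0_nonneg x
  | succ n ih => exact tsum_nonneg fun y => mul_nonneg (ih y) (soStep_nonneg _)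

/-- The summands of `D^{*n} * D` at `w` vanish off the neighbourhood of `w`. [folklore] -/
theorem convPow_mul_soStep_eq_zero {n : ℕ} {w u : Site d}
    (hu : u ∉ (spreadOutGraph d L).neighborFinset w) :
    convPow (soStep d L) n u * soStep d L (w - u) = 0 := by
  rw [soStep_sub, if_neg, mul_zero]
  intro h
  exact hu ((SimpleGraph.mem_neighborFinset _ _ _).2 h.symm)

/-- `D^{*(n+1)}(w) = Σ_{u ∼ w} D^{*n}(u) D(w - u)` — a finite sum. [folklore] -/
theorem convPow_succ_eq_sum (n : ℕ) (w : Site d) :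
    convPow (soStep d L) (n + 1) w =
      ∑ u ∈ (spreadOutGraph d L).neighborFinset w, convPow (soStep d L) n u * soStep d L (w - u) := by
  show latticeConv (convPow (soStep d L) n) (soStep d L) w = _
  unfold latticeConv
  exact tsum_eq_sum fun u hu => convPow_mul_soStep_eq_zero hu

/-- `Σ_{u ∼ w} D(w - u) ≤ 1` (`= 1` unless the graph has no edges). [folklore] -/
theorem sum_soStep_sub_le_one (w : Site d) :
    ∑ u ∈ (spreadOutGraph d L).neighborFinset w, soStep d L (w - u) ≤ 1 := by
  have hterm : ∀ u ∈ (spreadOutGraph d L).neighborFinset w,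
      soStep d L (w - u) = ((soCount d L : ℝ))⁻¹ := by
    intro u hu
    rw [soStep_sub, if_pos ((SimpleGraph.mem_neighborFinset _ _ _).1 hu).symm]
  rw [Finset.sum_congr rfl hterm, Finset.sum_const, card_neighborFinset_spreadOutGraph, nsmul_eq_mul]
  show (soCount d L : ℝ) * ((soCount d L : ℝ))⁻¹ ≤ 1
  rcases Nat.eq_zero_or_pos (soCount d L) with h | h
  · rw [h]; simp
  · rw [mul_inv_cancel₀ (by exact_mod_cast h.ne')]

/-- `D^{*n} ≤ 1` (an `n`-step transition probability). [folklore] -/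
theorem convPow_le_one (n : ℕ) (x : Site d) : convPow (soStep d L) n x ≤ 1 := by
  induction n generalizing x with
  | zero => unfold convPow delta0; split_ifs <;> norm_num
  | succ n ih =>
    rw [convPow_succ_eq_sum]
    calc ∑ u ∈ (spreadOutGraph d L).neighborFinset x, convPow (soStep d L) n u * soStep d L (x - u)
        ≤ ∑ u ∈ (spreadOutGraph d L).neighborFinset x, soStep d L (x - u) :=
          Finset.sum_le_sum fun u _ => by
            calc convPow (soStep d L) n u * soStep d L (x - u) ≤ 1 * soStep d L (x - u) :=
                  mul_le_mul_of_nonneg_right (ih u) (soStep_nonneg _)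
              _ = _ := one_mul _
      _ ≤ 1 := sum_soStep_sub_le_one x

/-- The series `S_μ(x) = Σ_n μⁿ D^{*n}(x)` converges for `0 ≤ μ < 1` (terms at most `μⁿ`). [folklore] -/
theorem summable_soGreen_terms {μ : ℝ} (hμ0 : 0 ≤ μ) (hμ1 : μ < 1) (x : Site d) :
    Summable fun n : ℕ => μ ^ n * convPow (soStep d L) n x := by
  refine Summable.of_nonneg_of_le (fun n => mul_nonneg (pow_nonneg hμ0 n) (convPow_nonneg n x))
    (fun n => ?_) (summable_geometric_of_lt_one hμ0 hμ1)
  calc μ ^ n * convPow (soStep d L) n x ≤ μ ^ n * 1 :=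
        mul_le_mul_of_nonneg_left (convPow_le_one n x) (pow_nonneg hμ0 n)
    _ = μ ^ n := mul_one _

/-- `S_μ ≥ 0` for `μ ≥ 0`. [folklore] -/
theorem soGreen_nonneg {μ : ℝ} (hμ0 : 0 ≤ μ) (x : Site d) : 0 ≤ soGreen d L μ x :=
  tsum_nonneg fun n => mul_nonneg (pow_nonneg hμ0 n) (convPow_nonneg n x)

/-- The key reindexing: `Σ_{y ∼ a} D^{*k}(x - y) D(y - a) = D^{*(k+1)}(x - a)`. [folklore] -/
theorem sum_convPow_mul_soStep_eq (k : ℕ) (a x : Site d) :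
    ∑ y ∈ (spreadOutGraph d L).neighborFinset a, convPow (soStep d L) k (x - y) * soStep d L (y - a) =
      convPow (soStep d L) (k + 1) (x - a) := by
  -- both sides are the `tsum` of `y ↦ D^{*k}(x - y) D(y - a)`, reindexed by `u = x - y`
  have hsupp : ∀ y ∉ (spreadOutGraph d L).neighborFinset a,
      convPow (soStep d L) k (x - y) * soStep d L (y - a) = 0 := by
    intro y hy
    rw [soStep_sub, if_neg, mul_zero]
    exact fun h => hy ((SimpleGraph.mem_neighborFinset _ _ _).2 h)
  have hlhs : ∑ y ∈ (spreadOutGraph d L).neighborFinset a,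
      convPow (soStep d L) k (x - y) * soStep d L (y - a) =
      ∑' y : Site d, convPow (soStep d L) k (x - y) * soStep d L (y - a) := (tsum_eq_sum hsupp).symm
  rw [hlhs]
  show _ = latticeConv (convPow (soStep d L) k) (soStep d L) (x - a)
  unfold latticeConv
  rw [← (Equiv.subLeft x).tsum_eq (fun u => convPow (soStep d L) k u * soStep d L (x - a - u))]
  refine tsum_congr fun y => ?_
  simp only [Equiv.subLeft_apply]
  congr 2
  abel

/-! ### The random-walk expansion in finite volume -/

/-- **One step** (the modified Simon inequality with `S = {a}`; Sakai's (4.2)): for `β ≥ 0` and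
`a, x ∈ Λ`, `⟨σ_aσ_x⟩^∅_{Λ;β} ≤ δ_{a,x} + tanh β · Σ_{y ∈ Λ, y ∼ a} ⟨σ_yσ_x⟩^∅_{Λ;β}`.
[cite: Sakai2007, §4.1, (4.2)] [cite: DuminilCopinTassionCMP2016, Lemma 2.7 (arXiv:1502.03050 numbering)] -/
theorem isingTwoPoint_le_delta_add {β : ℝ} (hβ : 0 ≤ β) {Λ : Finset (Site d)} {a x : Site d}
    (ha : a ∈ Λ) (hx : x ∈ Λ) :
    isingTwoPoint (spreadOutGraph d L) Λ β 0 .free a x ≤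
      delta0 (x - a) + Real.tanh β *
        ∑ y ∈ Λ.filter ((spreadOutGraph d L).Adj a), isingTwoPoint (spreadOutGraph d L) Λ β 0 .free y x := by
  have htanh : 0 ≤ Real.tanh β := tanh_nonneg hβ
  have hsum : 0 ≤ ∑ y ∈ Λ.filter ((spreadOutGraph d L).Adj a),
      isingTwoPoint (spreadOutGraph d L) Λ β 0 .free y x :=
    Finset.sum_nonneg fun y hy => isingTwoPoint_free_nonneg _ hβ (Finset.mem_filter.1 hy).1 hx
  by_cases hxa : x = a
  · subst hxa
    rw [isingTwoPoint_self, sub_self, delta0_zero]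
    linarith [mul_nonneg htanh hsum]
  · have hxS : x ∉ ({a} : Finset (Site d)) := by simpa using hxa
    have hms := isingTwoPoint_free_le_modifiedSimon (spreadOutGraph d L) hβ
      (Finset.singleton_subset_iff.2 ha) (Finset.mem_singleton_self a) hx hxS
    rw [Finset.sum_singleton, isingTwoPoint_self] at hms
    rw [delta0_of_ne_zero (sub_ne_zero.2 hxa), zero_add, Finset.mul_sum]
    refine hms.trans ?_
    simp only [mul_one]
    refine Finset.sum_le_sum_of_subset_of_nonneg ?_ fun y hy _ => ?_
    · intro y hy
      have hy' := Finset.mem_filter.1 hy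
      exact Finset.mem_filter.2 ⟨(Finset.mem_sdiff.1 hy'.1).1, hy'.2⟩
    · exact mul_nonneg htanh (isingTwoPoint_free_nonneg _ hβ (Finset.mem_filter.1 hy).1 hx)

/-- **The averaging step**: `tanh β · Σ_{y ∈ Λ, y ∼ a} D^{*k}(x - y) ≤ τ D^{*(k+1)}(x - a)`,
`τ = N_L tanh β` (extend the sum to all neighbours of `a` and use `D(y - a) = N_L⁻¹`).
[cite: Sakai2007, §4.1, footnote to (4.2) (repeated applications of (4.2))] -/
theorem tanh_mul_sum_convPow_le {β : ℝ} (hβ : 0 ≤ β) (Λ : Finset (Site d)) (k : ℕ)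
    (a x : Site d) :
    Real.tanh β * ∑ y ∈ Λ.filter ((spreadOutGraph d L).Adj a), convPow (soStep d L) k (x - y) ≤
      isingZ d L β * convPow (soStep d L) (k + 1) (x - a) := by
  have htanh : 0 ≤ Real.tanh β := tanh_nonneg hβ
  -- extend to all neighbours of `a`
  have h1' : ∑ y ∈ Λ.filter ((spreadOutGraph d L).Adj a), convPow (soStep d L) k (x - y) ≤
      ∑ y ∈ (spreadOutGraph d L).neighborFinset a, convPow (soStep d L) k (x - y) :=
    Finset.sum_le_sum_of_subset_of_nonneg
      (fun y hy => (SimpleGraph.mem_neighborFinset _ _ _).2 (Finset.mem_filter.1 hy).2)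
      fun y _ _ => convPow_nonneg k _
  -- `tanh β · c = τ · c · N_L⁻¹ = τ · c · D(y - a)` on the neighbourhood
  calc Real.tanh β * ∑ y ∈ Λ.filter ((spreadOutGraph d L).Adj a), convPow (soStep d L) k (x - y)
      ≤ Real.tanh β * ∑ y ∈ (spreadOutGraph d L).neighborFinset a, convPow (soStep d L) k (x - y) :=
        mul_le_mul_of_nonneg_left h1' htanh
    _ = ∑ y ∈ (spreadOutGraph d L).neighborFinset a,
          isingZ d L β * (convPow (soStep d L) k (x - y) * soStep d L (y - a)) := by
        rw [Finset.mul_sum]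
        refine Finset.sum_congr rfl fun y hy => ?_
        have hadj : (spreadOutGraph d L).Adj a y := (SimpleGraph.mem_neighborFinset _ _ _).1 hy
        have hN : (soCount d L : ℝ) ≠ 0 := by
          have : 0 < (spreadOutGraph d L).degree a := by
            rw [← SimpleGraph.card_neighborFinset_eq_degree]
            exact Finset.card_pos.2 ⟨y, hy⟩
          rw [← SimpleGraph.card_neighborFinset_eq_degree, card_neighborFinset_spreadOutGraph] at this
          exact_mod_cast this.ne'
        rw [soStep_sub, if_pos hadj, isingZ]
        field_simp
    _ = isingZ d L β * convPow (soStep d L) (k + 1) (x - a) := by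
        rw [← Finset.mul_sum, sum_convPow_mul_soStep_eq]

/-- **The random-walk expansion, iterated `n` times** (uniformly in the finite volume): for
`β ≥ 0`, `x ∈ Λ` and every `a ∈ Λ`,
`⟨σ_aσ_x⟩^∅_{Λ;β} ≤ Σ_{k<n} τᵏ D^{*k}(x - a) + τⁿ`, `τ = N_L tanh β` ("Repeated applications of (4.2)
…", Sakai 2007, §4.1, footnote; the remainder after `n` steps is at most `τⁿ` since the
finite-volume two-point functions are at most `1`).
[cite: Sakai2007, §4.1, footnote to (4.2) (random-walk bound)] -/
theorem isingTwoPoint_le_sum_convPow_add_pow {β : ℝ} (hβ : 0 ≤ β) {Λ : Finset (Site d)}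
    {x : Site d} (hx : x ∈ Λ) (n : ℕ) {a : Site d} (ha : a ∈ Λ) :
    isingTwoPoint (spreadOutGraph d L) Λ β 0 .free a x ≤
      ∑ k ∈ Finset.range n, isingZ d L β ^ k * convPow (soStep d L) k (x - a) + isingZ d L β ^ n := by
  have htanh : 0 ≤ Real.tanh β := tanh_nonneg hβ
  have hτ : 0 ≤ isingZ d L β := mul_nonneg (Nat.cast_nonneg _) htanh
  induction n generalizing a with
  | zero =>
    rw [Finset.sum_range_zero, zero_add, pow_zero]
    exact (le_abs_self _).trans (abs_isingTwoPoint_le_one _ _ _ _ _ _ _)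
  | succ n ih =>
    -- one Simon step, then the induction hypothesis at the neighbours
    have hstep := isingTwoPoint_le_delta_add (d := d) (L := L) hβ ha hx
    refine hstep.trans ?_
    have hIH : ∑ y ∈ Λ.filter ((spreadOutGraph d L).Adj a), isingTwoPoint (spreadOutGraph d L) Λ β 0 .free y x ≤
        ∑ y ∈ Λ.filter ((spreadOutGraph d L).Adj a),
          (∑ k ∈ Finset.range n, isingZ d L β ^ k * convPow (soStep d L) k (x - y) + isingZ d L β ^ n) :=
      Finset.sum_le_sum fun y hy => ih (Finset.mem_filter.1 hy).1
    -- the remainder: `tanh β · #{y ∈ Λ : y ∼ a} · τⁿ ≤ τ · τⁿ`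
    have hcard : (((Λ.filter ((spreadOutGraph d L).Adj a)).card : ℕ) : ℝ) ≤ soCount d L := by
      have h1 : (Λ.filter ((spreadOutGraph d L).Adj a)).card ≤ ((spreadOutGraph d L).neighborFinset a).card :=
        Finset.card_le_card fun y hy =>
          (SimpleGraph.mem_neighborFinset _ _ _).2 (Finset.mem_filter.1 hy).2
      rw [card_neighborFinset_spreadOutGraph] at h1
      exact_mod_cast h1
    have hrem : Real.tanh β * ∑ _y ∈ Λ.filter ((spreadOutGraph d L).Adj a), isingZ d L β ^ n ≤
        isingZ d L β ^ (n + 1) := by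
      rw [Finset.sum_const, nsmul_eq_mul]
      have hle : Real.tanh β * ((Λ.filter ((spreadOutGraph d L).Adj a)).card : ℝ) ≤ isingZ d L β := by
        rw [isingZ, mul_comm]
        exact mul_le_mul_of_nonneg_right hcard htanh
      calc Real.tanh β * (((Λ.filter ((spreadOutGraph d L).Adj a)).card : ℝ) * isingZ d L β ^ n)
          = Real.tanh β * ((Λ.filter ((spreadOutGraph d L).Adj a)).card : ℝ) * isingZ d L β ^ n := by
            ring
        _ ≤ isingZ d L β * isingZ d L β ^ n := mul_le_mul_of_nonneg_right hle (pow_nonneg hτ n)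
        _ = isingZ d L β ^ (n + 1) := by ring
    -- the main terms: exchange the sums and average
    have hmain : Real.tanh β * ∑ y ∈ Λ.filter ((spreadOutGraph d L).Adj a),
        ∑ k ∈ Finset.range n, isingZ d L β ^ k * convPow (soStep d L) k (x - y) ≤
        ∑ k ∈ Finset.range n, isingZ d L β ^ (k + 1) * convPow (soStep d L) (k + 1) (x - a) := by
      rw [Finset.sum_comm, Finset.mul_sum]
      refine Finset.sum_le_sum fun k _ => ?_
      rw [← Finset.mul_sum, ← mul_assoc, mul_comm (Real.tanh β), mul_assoc, pow_succ, mul_assoc]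
      refine mul_le_mul_of_nonneg_left ?_ (pow_nonneg hτ k)
      exact tanh_mul_sum_convPow_le hβ Λ k a x
    -- assemble: `δ + Σ_{k<n} τ^{k+1}D^{*(k+1)} + τ^{n+1} = Σ_{k<n+1} τᵏD^{*k} + τ^{n+1}`
    calc delta0 (x - a) + Real.tanh β * ∑ y ∈ Λ.filter ((spreadOutGraph d L).Adj a),
          isingTwoPoint (spreadOutGraph d L) Λ β 0 .free y x
        ≤ delta0 (x - a) + Real.tanh β * ∑ y ∈ Λ.filter ((spreadOutGraph d L).Adj a),
            (∑ k ∈ Finset.range n, isingZ d L β ^ k * convPow (soStep d L) k (x - y) + isingZ d L β ^ n) :=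
          add_le_add le_rfl (mul_le_mul_of_nonneg_left hIH htanh)
      _ = delta0 (x - a) + (Real.tanh β * ∑ y ∈ Λ.filter ((spreadOutGraph d L).Adj a),
            ∑ k ∈ Finset.range n, isingZ d L β ^ k * convPow (soStep d L) k (x - y) +
            Real.tanh β * ∑ _y ∈ Λ.filter ((spreadOutGraph d L).Adj a), isingZ d L β ^ n) := by
          rw [Finset.sum_add_distrib, mul_add]
      _ ≤ delta0 (x - a) + (∑ k ∈ Finset.range n, isingZ d L β ^ (k + 1) * convPow (soStep d L) (k + 1) (x - a) +
            isingZ d L β ^ (n + 1)) := add_le_add le_rfl (add_le_add hmain hrem)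
      _ = ∑ k ∈ Finset.range (n + 1), isingZ d L β ^ k * convPow (soStep d L) k (x - a) +
            isingZ d L β ^ (n + 1) := by
          rw [Finset.sum_range_succ', pow_zero, one_mul]
          show delta0 (x - a) + _ = _ + convPow (soStep d L) 0 (x - a) + _
          simp only [convPow]
          ring

/-! ### Infinite volume -/

/-- `tanh` is strictly increasing. [folklore] -/
theorem tanh_lt_tanh {x y : ℝ} (h : x < y) : Real.tanh x < Real.tanh y :=
  lt_of_le_of_ne (tanh_le_tanh h.le) fun heq => (ne_of_lt h) (Real.tanh_injective heq)

/-- **The random-walk bound for `τ < 1`** (no transience needed): `G_β(x) ≤ S_τ(x)`,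
`τ = N_L tanh β < 1`, `β ≥ 0` — the finite-volume expansion `isingTwoPoint_le_sum_convPow_add_pow`
at `a = 0`, `n → ∞` (`τⁿ → 0`, the series being dominated by `Σ τⁿ`), then the supremum over boxes.
[cite: Sakai2007, §4.1, footnote to (4.2) (random-walk bound ⟨φ_oφ_x⟩_Λ ≤ S_τ(x))] -/
theorem spreadOutTwoPoint_le_soGreen_of_lt_one {β : ℝ} (hβ : 0 ≤ β) (hτ1 : isingZ d L β < 1)
    (x : Site d) : spreadOutTwoPoint d L β x ≤ soGreen d L (isingZ d L β) x := by
  have hτ0 : 0 ≤ isingZ d L β := mul_nonneg (Nat.cast_nonneg _) (tanh_nonneg hβ)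
  have hsum : Summable fun n : ℕ => isingZ d L β ^ n * convPow (soStep d L) n x :=
    summable_soGreen_terms hτ0 hτ1 x
  have hlim : Tendsto (fun n : ℕ =>
      ∑ k ∈ Finset.range n, isingZ d L β ^ k * convPow (soStep d L) k x + isingZ d L β ^ n)
      atTop (𝓝 (soGreen d L (isingZ d L β) x + 0)) :=
    hsum.hasSum.tendsto_sum_nat.add (tendsto_pow_atTop_nhds_zero_of_lt_one hτ0 hτ1)
  rw [add_zero] at hlim
  refine ciSup_le fun N => ?_
  by_cases hx : x ∈ box d N
  · refine ge_of_tendsto' hlim fun n => ?_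
    have h := isingTwoPoint_le_sum_convPow_add_pow (d := d) (L := L) hβ hx n (zero_mem_box d N)
    rw [sub_zero] at h
    exact h
  · rw [boxTwoPoint_of_not_mem β hx]
    exact soGreen_nonneg hτ0 x

/-- **The random-walk bound for `τ ≤ 1`, given the convergence of `S_1 = Σ_n D^{*n}`** (transience):
at `τ = 1` (so `β > 0`), `G_β(x) = sup_{β' < β} G_{β'}(x)` by the lower semicontinuity of the
monotone volume limit, and for `β' < β`, `τ' < 1`, `G_{β'} ≤ S_{τ'} ≤ S_1` termwise.
[cite: Sakai2007, §4.1, footnote to (4.2) (random-walk bound, τ ≤ 1)] -/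
theorem spreadOutTwoPoint_le_soGreen_of_summable {β : ℝ} (hβ : 0 ≤ β) (hτ1 : isingZ d L β ≤ 1)
    (hS : ∀ y : Site d, Summable fun n : ℕ => convPow (soStep d L) n y) (x : Site d) :
    spreadOutTwoPoint d L β x ≤ soGreen d L (isingZ d L β) x := by
  rcases lt_or_eq_of_le hτ1 with hlt | heq
  · exact spreadOutTwoPoint_le_soGreen_of_lt_one hβ hlt x
  · have hN : (0 : ℝ) < soCount d L := by
      by_contra hN
      push Not at hN
      have hN0 : (soCount d L : ℝ) = 0 := le_antisymm hN (Nat.cast_nonneg _)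
      rw [isingZ, hN0, zero_mul] at heq
      exact zero_ne_one heq
    have hβpos : 0 < β := by
      rcases eq_or_lt_of_le hβ with h | h
      · rw [← h, isingZ, Real.tanh_zero, mul_zero] at heq
        exact absurd heq zero_ne_one
      · exact h
    rw [heq]
    refine spreadOutTwoPoint_le_of_forall_lt hβpos fun β' hβ'0 hβ'lt => ?_
    have hτ'lt : isingZ d L β' < 1 := by
      rw [← heq]
      exact mul_lt_mul_of_pos_left (tanh_lt_tanh hβ'lt) hN
    have hτ'0 : 0 ≤ isingZ d L β' := mul_nonneg (Nat.cast_nonneg _) (tanh_nonneg hβ'0)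
    refine (spreadOutTwoPoint_le_soGreen_of_lt_one hβ'0 hτ'lt x).trans ?_
    refine Summable.tsum_le_tsum (fun n => ?_) (summable_soGreen_terms hτ'0 hτ'lt x)
      ((hS x).congr fun n => by rw [one_pow, one_mul])
    rw [one_pow, one_mul]
    calc isingZ d L β' ^ n * convPow (soStep d L) n x ≤ 1 * convPow (soStep d L) n x :=
          mul_le_mul_of_nonneg_right (pow_le_one₀ hτ'0 hτ'lt.le) (convPow_nonneg n x)
      _ = convPow (soStep d L) n x := one_mul _

/-- NAMED FACT — **transience of the spread-out random walk in `d > 2`**: the Green function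
series `S_1(x) = Σ_{n ≥ 0} D^{*n}(x)` converges for every `x` (`d > 2`, `L ≥ 1`), i.e. the expected
number of visits to `x` is finite. This is what makes `S_1` a function in the sources: "the
spread-out Green function … `S_μ(x) = ∫ e^{-ik·x}/(1 - μD̂(k)) dk/(2π)^d` (`d > 2`)" (Liu–Slade
2026, (1.6)–(1.7), citing Lawler–Limic and Uchiyama for `S_1`); "The leading asymptotics of
`S_1(x)` for `d > 2` is known as `a_d σ⁻² |x|^{-(d-2)}`" (Sakai 2007, after (1.19)). A classical
random-walk statement; PROVED below (section `Transience`, `soWalk_transient_holds`) by the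
Fourier representation `D^{*n}(x) = (2π)^{-d}∫ D̂ⁿ cos(k·x) dk` and the integrability of
`1/(1 - D̂)` on `[-π,π]^d` in `d ≥ 3`.
[cite: LiuSlade2026, §1.2.1, (1.6)–(1.8) (S_μ and C_1 for d > 2)] [cite: Sakai2007, §1.2, (1.19) and the sentence after it] -/
def soWalk_transient : Prop :=
  ∀ d L : ℕ, 2 < d → 1 ≤ L → ∀ x : Site d, Summable fun n : ℕ => convPow (soStep d L) n x

/-- For `L = 0` the range-`0` graph has no edges: `N_0 = 0`. [folklore] -/
theorem soCount_zero_range (d : ℕ) : soCount d 0 = 0 := by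
  rw [soCount, ← SimpleGraph.card_neighborFinset_eq_degree, Finset.card_eq_zero,
    Finset.eq_empty_iff_forall_notMem]
  intro y hy
  rw [SimpleGraph.mem_neighborFinset, spreadOutGraph_adj_iff] at hy
  obtain ⟨hne, hle⟩ := hy
  refine hne (funext fun i => ?_)
  have h := hle i
  simp only [Pi.zero_apply, zero_sub, abs_neg, Nat.cast_zero, abs_nonpos_iff] at h
  exact h.symm

/-- **The random-walk bound `spreadOutTwoPoint_le_soGreen` follows from the transience fact**
(for `τ < 1` unconditionally; transience enters only at `τ = 1`, which forces `L ≥ 1`).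
[cite: Sakai2007, §4.1, footnote to (4.2)] -/
theorem spreadOutTwoPoint_le_soGreen_of_transient (h : soWalk_transient) :
    spreadOutTwoPoint_le_soGreen := by
  intro d L hd β hβ hτ x
  rcases lt_or_eq_of_le hτ with hlt | heq
  · exact spreadOutTwoPoint_le_soGreen_of_lt_one hβ hlt x
  · have hL : 1 ≤ L := by
      by_contra hL0
      have hL' : L = 0 := by omega
      subst hL'
      rw [isingZ, soCount_zero_range, Nat.cast_zero, zero_mul] at heq
      exact zero_ne_one heq
    exact spreadOutTwoPoint_le_soGreen_of_summable hβ hτ (h d L hd hL) x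

/-- **Assumption 1.3 for the Ising family from the transience fact alone**, and Sakai's Theorem 1.3
(spread-out) from: Liu–Slade Prop. 1.2 and Thm. 1.7, Sakai's lace expansion with diagrammatic
bounds, and the transience of the spread-out walk. [cite: LiuSlade2026, Assumption 1.3 and Theorem 1.7] [cite: Sakai2007, Theorem 1.3 (SO model)] -/
theorem Sakai2007_thm13_spreadOut_of_LS'' (h0 : LiuSlade2026_prop12_greenBound)
    (h1 : LiuSlade2026_thm17) (h2 : Sakai2007_isingAssumptionH) (hT : soWalk_transient) :
    Sakai2007_thm13_spreadOut :=
  Sakai2007_thm13_spreadOut_of_LS' h0 h1 h2 (spreadOutTwoPoint_le_soGreen_of_transient hT)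

/-! ## Transience -/

section Transience

open Real
open Literature.Probability.Percolation (kdot_add kdot_neg integral_cexp_neg_kdot)
open Literature.Barriers.CriticalPhenomena.Slade2006Prop53 (P volume_restrict_cube)


/-- `∫_{[-π,π]^d} cos(k·x) dk = (2π)^d 1{x = 0}` for `x ∈ ℤ^d` (real part of the tree's orthogonality
`integral_cexp_neg_kdot` of `InfraredTriangleAnalysis.lean`). [folklore] -/
theorem integral_cube_cos_kdot (x : Site d) :
    ∫ k in cube d, Real.cos (kdot k x) = if x = 0 then (2 * π) ^ d else 0 := by
  have hint : Integrable (fun k : Fin d → ℝ => Complex.exp (-(Complex.I * (kdot k x : ℝ))))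
      (volume.restrict (cube d)) := by
    refine ContinuousOn.integrableOn_compact (isCompact_univ_pi fun _ => isCompact_Icc) ?_
    refine (Complex.continuous_exp.comp (continuous_const.mul ?_).neg).continuousOn
    exact Complex.continuous_ofReal.comp (continuous_finsetSum _ fun j _ =>
      (continuous_apply j).mul continuous_const)
  have hP : (volume : Measure (Fin d → ℝ)).restrict (cube d) = P d := volume_restrict_cube d
  have hre : ∀ k : Fin d → ℝ, Real.cos (kdot k x) =
      RCLike.re (Complex.exp (-(Complex.I * (kdot k x : ℝ)))) := by
    intro k
    rw [show -(Complex.I * ((kdot k x : ℝ) : ℂ)) = ((-kdot k x : ℝ) : ℂ) * Complex.I by push_cast; ring,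
      RCLike.re_eq_complex_re, Complex.exp_ofReal_mul_I_re, Real.cos_neg]
  simp_rw [hre]
  rw [integral_re hint, hP, integral_cexp_neg_kdot]
  split_ifs
  · rw [show ((2 * π) ^ d : ℂ) = (((2 * π) ^ d : ℝ) : ℂ) by push_cast; ring, RCLike.re_eq_complex_re,
      Complex.ofReal_re]
  · simp

/-! ### The symbol `D̂` of the step distribution -/

/-- The symbol (characteristic function) of the step distribution,
`D̂(k) = Σ_x D(x) cos(k·x)` (real, `D` being symmetric). [cite: LiuSlade2026, §1.2.1, (1.7) (D̂ in the Green function)] -/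
def soSymbol (d L : ℕ) (k : Fin d → ℝ) : ℝ :=
  ∑ y ∈ (spreadOutGraph d L).neighborFinset 0, soStep d L y * Real.cos (kdot k y)

/-- `k·(x - y) = k·x - k·y`. [folklore] -/
theorem kdot_sub (k : Fin d → ℝ) (x y : Site d) : kdot k (x - y) = kdot k x - kdot k y := by
  rw [sub_eq_add_neg, kdot_add, kdot_neg, ← sub_eq_add_neg]

/-- `k·e_j = k_j`. [folklore] -/
theorem kdot_single_right (k : Fin d → ℝ) (j : Fin d) : kdot k (Pi.single j 1) = k j := by
  unfold kdot
  rw [Finset.sum_eq_single j]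
  · simp
  · intro i _ hij
    simp [hij]
  · intro h; exact absurd (Finset.mem_univ j) h

/-- `k ↦ k·x` is continuous. [folklore] -/
theorem continuous_kdot_left (x : Site d) : Continuous fun k : Fin d → ℝ => kdot k x :=
  continuous_finsetSum _ fun j _ => (continuous_apply j).mul continuous_const

/-- `D̂` is continuous. [folklore] -/
theorem continuous_soSymbol : Continuous (soSymbol d L) := by
  unfold soSymbol
  exact continuous_finsetSum _ fun y _ =>
    continuous_const.mul (Real.continuous_cos.comp (continuous_kdot_left y))

/-- `Σ_x D(x) ≤ 1` (`= 1` unless the graph has no edges). [folklore] -/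
theorem sum_soStep_le_one : ∑ y ∈ (spreadOutGraph d L).neighborFinset 0, soStep d L y ≤ 1 := by
  have h := sum_soStep_sub_le_one (d := d) (L := L) 0
  have hre : ∑ u ∈ (spreadOutGraph d L).neighborFinset 0, soStep d L (0 - u) =
      ∑ y ∈ (spreadOutGraph d L).neighborFinset 0, soStep d L y := by
    refine Finset.sum_nbij' (fun u => -u) (fun y => -y) ?_ ?_ (fun u _ => by simp)
      (fun y _ => by simp) (fun u _ => by rw [zero_sub])
    · intro u hu
      rw [SimpleGraph.mem_neighborFinset, spreadOutGraph_adj_iff] at hu ⊢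
      refine ⟨fun h => hu.1 (by rw [← neg_neg u, ← h, neg_zero]), fun i => ?_⟩
      simpa using hu.2 i
    · intro y hy
      rw [SimpleGraph.mem_neighborFinset, spreadOutGraph_adj_iff] at hy ⊢
      refine ⟨fun h => hy.1 (by rw [← neg_neg y, ← h, neg_zero]), fun i => ?_⟩
      simpa using hy.2 i
  rwa [hre] at h

/-- `|D̂(k)| ≤ 1`. [folklore] -/
theorem abs_soSymbol_le_one (k : Fin d → ℝ) : |soSymbol d L k| ≤ 1 := by
  unfold soSymbol
  refine (Finset.abs_sum_le_sum_abs _ _).trans ?_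
  calc ∑ y ∈ (spreadOutGraph d L).neighborFinset 0, |soStep d L y * Real.cos (kdot k y)|
      ≤ ∑ y ∈ (spreadOutGraph d L).neighborFinset 0, soStep d L y := by
        refine Finset.sum_le_sum fun y _ => ?_
        rw [abs_mul, abs_of_nonneg (soStep_nonneg y)]
        calc soStep d L y * |Real.cos (kdot k y)| ≤ soStep d L y * 1 :=
              mul_le_mul_of_nonneg_left (Real.abs_cos_le_one _) (soStep_nonneg y)
          _ = soStep d L y := mul_one _
    _ ≤ 1 := sum_soStep_le_one

/-- `D̂(0) = Σ_x D(x) = 1` for `d, L ≥ 1`. [folklore] -/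
theorem soSymbol_zero (hd : 1 ≤ d) (hL : 1 ≤ L) : soSymbol d L 0 = 1 := by
  unfold soSymbol
  simp only [kdot_zero_left, Real.cos_zero, mul_one]
  exact sum_soStep_eq_one hd hL

/-- `|D|` is summable (finite support). [folklore] -/
theorem summable_abs_soStep : Summable fun y : Site d => |soStep d L y| :=
  summable_of_ne_finset_zero (s := (spreadOutGraph d L).neighborFinset 0) fun y hy => by
    rw [soStep_of_not_adj fun h => hy ((SimpleGraph.mem_neighborFinset _ _ _).2 h), abs_zero]

/-- **Bridge to the catalogue's lattice Fourier transform**: `soSymbol d L k = Re D̂(k)` with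
`D̂ = latticeFT (soStep d L)` (`LaceExpansionXSpaceAsymptotics.lean`; `re_latticeFT`), the `tsum`
collapsing to the finite sum over the neighbourhood of the origin. (So the Hara/Liu–Slade
framework objects phrased through `latticeFT` apply to `soStep` with this working definition.)
[folklore] -/
theorem soSymbol_eq_re_latticeFT (k : Fin d → ℝ) : (latticeFT (soStep d L) k).re = soSymbol d L k := by
  rw [re_latticeFT summable_abs_soStep k, soSymbol]
  exact tsum_eq_sum fun y hy => by
    rw [soStep_of_not_adj fun h => hy ((SimpleGraph.mem_neighborFinset _ _ _).2 h), zero_mul]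

/-- The Brillouin zone of `LatticeGreenFunction.lean` is the cube of `LaceExpansionXSpaceAsymptotics.lean`
(both `[-π,π]^d`); recorded to make the use of `dispersion_pos_of_mem_brillouin`,
`measurableSet_brillouin` and `integrable_indicator_inv_dispersion` on `cube d` visible. [folklore] -/
theorem cube_eq_brillouin : cube d = brillouin d := rfl

/-- The neighbourhood of the origin is symmetric: `-y ∼ 0 ↔ y ∼ 0`. [folklore] -/
theorem neg_mem_neighborFinset_zero_iff (y : Site d) :
    -y ∈ (spreadOutGraph d L).neighborFinset 0 ↔ y ∈ (spreadOutGraph d L).neighborFinset 0 := by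
  rw [SimpleGraph.mem_neighborFinset, SimpleGraph.mem_neighborFinset, spreadOutGraph_adj_iff,
    spreadOutGraph_adj_iff]
  refine and_congr ⟨fun h h' => h (by rw [← h', neg_zero]), fun h h' => h ?_⟩ (forall_congr' fun i => ?_)
  · rw [← neg_neg y, ← h', neg_zero]
  · simp

/-- `D(-y) = D(y)`. [folklore] -/
theorem soStep_neg (y : Site d) : soStep d L (-y) = soStep d L y := by
  unfold soStep
  have h : (spreadOutGraph d L).Adj 0 (-y) ↔ (spreadOutGraph d L).Adj 0 y := by
    rw [← SimpleGraph.mem_neighborFinset, ← SimpleGraph.mem_neighborFinset]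
    exact neg_mem_neighborFinset_zero_iff y
  exact if_congr h rfl rfl

/-- The sine part of the symbol vanishes: `Σ_x D(x) sin(k·x) = 0` (symmetry `x ↦ -x`). [folklore] -/
theorem sum_soStep_mul_sin_eq_zero (k : Fin d → ℝ) :
    ∑ y ∈ (spreadOutGraph d L).neighborFinset 0, soStep d L y * Real.sin (kdot k y) = 0 := by
  set S := ∑ y ∈ (spreadOutGraph d L).neighborFinset 0, soStep d L y * Real.sin (kdot k y) with hS
  have hneg : S = -S := by
    calc S = ∑ y ∈ (spreadOutGraph d L).neighborFinset 0, soStep d L (-y) * Real.sin (kdot k (-y)) := by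
          rw [hS]
          refine Finset.sum_nbij' (fun y => -y) (fun y => -y) ?_ ?_ (fun y _ => by simp)
            (fun y _ => by simp) (fun y _ => by rw [neg_neg])
          · intro y hy; exact (neg_mem_neighborFinset_zero_iff y).2 hy
          · intro y hy; exact (neg_mem_neighborFinset_zero_iff y).2 hy
      _ = -S := by
          rw [hS, ← Finset.sum_neg_distrib]
          refine Finset.sum_congr rfl fun y _ => ?_
          rw [soStep_neg, kdot_neg, Real.sin_neg, mul_neg]
  linarith

/-- **`Σ_y D(y) cos(k·(x - y)) = D̂(k) cos(k·x)`** (the convolution with a character). [folklore] -/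
theorem sum_soStep_mul_cos_sub (k : Fin d → ℝ) (x : Site d) :
    ∑ y ∈ (spreadOutGraph d L).neighborFinset 0, soStep d L y * Real.cos (kdot k (x - y)) =
      soSymbol d L k * Real.cos (kdot k x) := by
  simp_rw [kdot_sub, Real.cos_sub, mul_add, Finset.sum_add_distrib]
  have h1 : ∑ y ∈ (spreadOutGraph d L).neighborFinset 0,
      soStep d L y * (Real.cos (kdot k x) * Real.cos (kdot k y)) =
      soSymbol d L k * Real.cos (kdot k x) := by
    unfold soSymbol
    rw [Finset.sum_mul]
    refine Finset.sum_congr rfl fun y _ => ?_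
    ring
  have h2 : ∑ y ∈ (spreadOutGraph d L).neighborFinset 0,
      soStep d L y * (Real.sin (kdot k x) * Real.sin (kdot k y)) = 0 := by
    have := sum_soStep_mul_sin_eq_zero (d := d) (L := L) k
    calc ∑ y ∈ (spreadOutGraph d L).neighborFinset 0,
          soStep d L y * (Real.sin (kdot k x) * Real.sin (kdot k y))
        = Real.sin (kdot k x) *
            ∑ y ∈ (spreadOutGraph d L).neighborFinset 0, soStep d L y * Real.sin (kdot k y) := by
          rw [Finset.mul_sum]
          refine Finset.sum_congr rfl fun y _ => ?_
          ring
      _ = 0 := by rw [this, mul_zero]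
  rw [h1, h2, add_zero]

/-! ### The Fourier representation of the convolution powers -/

/-- `k ↦ D̂(k)ⁿ cos(k·x)` is integrable on the cube. [folklore] -/
theorem integrableOn_soSymbol_pow_mul_cos (n : ℕ) (x : Site d) :
    IntegrableOn (fun k => soSymbol d L k ^ n * Real.cos (kdot k x)) (cube d) volume :=
  ContinuousOn.integrableOn_compact (isCompact_univ_pi fun _ => isCompact_Icc)
    ((continuous_soSymbol.pow n).mul (Real.continuous_cos.comp (continuous_kdot_left x))).continuousOn

/-- Reindexing a neighbourhood sum: `Σ_{u ∼ x} f(u) D(x - u) = Σ_{y ∼ 0} D(y) f(x - y)`. [folklore] -/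
theorem sum_neighborFinset_reindex (f : Site d → ℝ) (x : Site d) :
    ∑ u ∈ (spreadOutGraph d L).neighborFinset x, f u * soStep d L (x - u) =
      ∑ y ∈ (spreadOutGraph d L).neighborFinset 0, soStep d L y * f (x - y) := by
  refine Finset.sum_nbij' (fun u => x - u) (fun y => x - y) ?_ ?_ (fun u _ => sub_sub_cancel x u)
    (fun y _ => sub_sub_cancel x y) (fun u _ => by rw [sub_sub_cancel, mul_comm])
  · intro u hu
    rw [SimpleGraph.mem_neighborFinset] at hu ⊢
    exact (spreadOutGraph_adj_iff_sub d L u x).1 hu.symm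
  · intro y hy
    rw [SimpleGraph.mem_neighborFinset] at hy ⊢
    have h := (spreadOutGraph_adj_iff_sub d L (x - y) x).2 (by rwa [sub_sub_cancel])
    exact h.symm

/-- **`D^{*n}(x) = (2π)^{-d} ∫_{[-π,π]^d} D̂(k)ⁿ cos(k·x) dk`** — the Fourier representation of the
`n`-step transition function (the source's `S_μ(x) = ∫ e^{-ik·x}/(1 - μD̂(k)) dk/(2π)^d` term by
term). [cite: LiuSlade2026, §1.1 (1.4) (Fourier inversion); §1.2.1 (1.7) (S_μ)] -/
theorem convPow_eq_integral (n : ℕ) (x : Site d) :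
    convPow (soStep d L) n x =
      ((2 * π) ^ d)⁻¹ * ∫ k in cube d, soSymbol d L k ^ n * Real.cos (kdot k x) := by
  have hπ : ((2 * π) ^ d : ℝ) ≠ 0 := pow_ne_zero _ (by positivity)
  induction n generalizing x with
  | zero =>
    simp only [pow_zero, one_mul]
    rw [integral_cube_cos_kdot]
    unfold convPow delta0
    split_ifs
    · rw [inv_mul_cancel₀ hπ]
    · rw [mul_zero]
  | succ n ih =>
    rw [convPow_succ_eq_sum, sum_neighborFinset_reindex]
    -- right side: `D̂^{n+1} cos(k·x) = D̂ⁿ Σ_y D(y) cos(k·(x-y))`, then swap sum and integral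
    have hswap : ∫ k in cube d, soSymbol d L k ^ (n + 1) * Real.cos (kdot k x) =
        ∑ y ∈ (spreadOutGraph d L).neighborFinset 0,
          soStep d L y * ∫ k in cube d, soSymbol d L k ^ n * Real.cos (kdot k (x - y)) := by
      have hfun : (fun k => soSymbol d L k ^ (n + 1) * Real.cos (kdot k x)) =
          fun k => ∑ y ∈ (spreadOutGraph d L).neighborFinset 0,
            soStep d L y * (soSymbol d L k ^ n * Real.cos (kdot k (x - y))) := by
        funext k
        rw [pow_succ, mul_assoc, ← sum_soStep_mul_cos_sub k x, Finset.mul_sum]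
        refine Finset.sum_congr rfl fun y _ => ?_
        ring
      rw [hfun, integral_finsetSum _ fun y _ =>
        (integrableOn_soSymbol_pow_mul_cos n (x - y)).const_mul (soStep d L y)]
      refine Finset.sum_congr rfl fun y _ => ?_
      exact integral_const_mul _ _
    rw [hswap, Finset.mul_sum]
    refine Finset.sum_congr rfl fun y _ => ?_
    rw [ih (x - y)]
    ring

/-! ### The infrared bound of the symbol and the transience -/

/-- **`1 - D̂(k) ≥ (2/N_L) ε(k)`**, `ε(k) = Σ_j (1 - cos k_j)` (the unit vectors `±e_j` alone):
the spread-out walk is at least as diffusive as `N_L⁻¹ ×` the simple walk. [folklore] -/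
theorem mul_dispersion_le_one_sub_soSymbol (hd : 1 ≤ d) (hL : 1 ≤ L) (k : Fin d → ℝ) :
    2 / soCount d L * dispersion k ≤ 1 - soSymbol d L k := by
  have hN : (0 : ℝ) < soCount d L := by exact_mod_cast soCount_pos hd hL
  -- `1 - D̂(k) = Σ_y D(y)(1 - cos(k·y))`
  have hrepr : 1 - soSymbol d L k =
      ∑ y ∈ (spreadOutGraph d L).neighborFinset 0, soStep d L y * (1 - Real.cos (kdot k y)) := by
    have h1 := sum_soStep_eq_one (d := d) (L := L) hd hL
    calc 1 - soSymbol d L k = ∑ y ∈ (spreadOutGraph d L).neighborFinset 0, soStep d L y -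
          ∑ y ∈ (spreadOutGraph d L).neighborFinset 0, soStep d L y * Real.cos (kdot k y) := by
            rw [h1]; simp only [soSymbol]
      _ = ∑ y ∈ (spreadOutGraph d L).neighborFinset 0,
            (soStep d L y - soStep d L y * Real.cos (kdot k y)) := (Finset.sum_sub_distrib _ _).symm
      _ = _ := Finset.sum_congr rfl fun y _ => by ring
  rw [hrepr]
  -- the subset `{e_j} ∪ {-e_j}`
  set E : Finset (Site d) := (Finset.univ.image fun j : Fin d => (Pi.single j (1 : ℤ) : Site d)) ∪
    (Finset.univ.image fun j : Fin d => (-Pi.single j (1 : ℤ) : Site d)) with hE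
  have hterm : ∀ y, 0 ≤ soStep d L y * (1 - Real.cos (kdot k y)) := fun y =>
    mul_nonneg (soStep_nonneg y) (by linarith [Real.cos_le_one (kdot k y)])
  have hsingle_adj : ∀ j : Fin d, (spreadOutGraph d L).Adj 0 (Pi.single j (1 : ℤ)) := by
    intro j
    rw [spreadOutGraph_adj_iff]
    refine ⟨fun h => ?_, fun i => ?_⟩
    · have := congrFun h j; simp at this
    · have hL' : (1 : ℤ) ≤ L := by exact_mod_cast hL
      by_cases hij : i = j
      · subst hij; simpa using hL'
      · simp [hij]
  have hEsub : E ⊆ (spreadOutGraph d L).neighborFinset 0 := by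
    intro y hy
    rw [hE, Finset.mem_union, Finset.mem_image, Finset.mem_image] at hy
    rw [SimpleGraph.mem_neighborFinset]
    rcases hy with ⟨j, _, rfl⟩ | ⟨j, _, rfl⟩
    · exact hsingle_adj j
    · rw [← SimpleGraph.mem_neighborFinset, neg_mem_neighborFinset_zero_iff,
        SimpleGraph.mem_neighborFinset]
      exact hsingle_adj j
  refine le_trans ?_ (Finset.sum_le_sum_of_subset_of_nonneg hEsub fun y _ _ => hterm y)
  -- evaluate the sum over `E`
  have hinj1 : Function.Injective fun j : Fin d => (Pi.single j (1 : ℤ) : Site d) := by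
    intro i j h
    by_contra hij
    have := congrFun h i
    simp [hij] at this
  have hinj2 : Function.Injective fun j : Fin d => (-Pi.single j (1 : ℤ) : Site d) :=
    fun i j h => hinj1 (neg_injective h)
  have hdisj : Disjoint (Finset.univ.image fun j : Fin d => (Pi.single j (1 : ℤ) : Site d))
      (Finset.univ.image fun j : Fin d => (-Pi.single j (1 : ℤ) : Site d)) := by
    rw [Finset.disjoint_left]
    intro y hy hy'
    rw [Finset.mem_image] at hy hy'
    obtain ⟨i, _, rfl⟩ := hy
    obtain ⟨j, _, h⟩ := hy'
    have := congrFun h j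
    by_cases hij : j = i
    · subst hij; simp at this
    · simp [hij] at this
  have hval : ∀ j : Fin d, soStep d L (Pi.single j 1) = ((soCount d L : ℝ))⁻¹ := fun j =>
    if_pos (hsingle_adj j)
  rw [hE, Finset.sum_union hdisj, Finset.sum_image fun i _ j _ h => hinj1 h,
    Finset.sum_image fun i _ j _ h => hinj2 h]
  simp only [soStep_neg, kdot_neg, Real.cos_neg, hval, kdot_single_right]
  rw [← Finset.sum_add_distrib, dispersion, Finset.mul_sum]
  refine Finset.sum_le_sum fun j _ => le_of_eq ?_
  field_simp
  ring

/-- **`D̂(k) < 1` on the cube away from the origin** (`d, L ≥ 1`). [folklore] -/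
theorem soSymbol_lt_one (hd : 1 ≤ d) (hL : 1 ≤ L) {k : Fin d → ℝ} (hk : k ∈ cube d) (hk0 : k ≠ 0) :
    soSymbol d L k < 1 := by
  have hN : (0 : ℝ) < soCount d L := by exact_mod_cast soCount_pos hd hL
  have hε : 0 < dispersion k := dispersion_pos_of_mem_brillouin hk hk0
  have h := mul_dispersion_le_one_sub_soSymbol hd hL k
  have : 0 < 2 / soCount d L * dispersion k := by positivity
  linarith

/-- Partial geometric sums: `|Σ_{n<M} tⁿ| ≤ 2/(1 - t)` for `-1 ≤ t < 1`. [folklore] -/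
theorem abs_geom_sum_le {t : ℝ} (ht : -1 ≤ t) (ht1 : t < 1) (M : ℕ) :
    |∑ n ∈ Finset.range M, t ^ n| ≤ 2 / (1 - t) := by
  have h1t : 0 < 1 - t := by linarith
  rw [geom_sum_eq ht1.ne, abs_div, show |t - 1| = 1 - t by rw [abs_sub_comm]; exact abs_of_pos h1t]
  refine div_le_div_of_nonneg_right ?_ h1t.le
  have htabs : |t| ≤ 1 := abs_le.2 ⟨ht, ht1.le⟩
  calc |t ^ M - 1| ≤ |t ^ M| + |(1 : ℝ)| := abs_sub _ _
    _ ≤ 1 + 1 := by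
        rw [abs_one, abs_pow]
        exact add_le_add (pow_le_one₀ (abs_nonneg t) htabs) le_rfl
    _ = 2 := by norm_num

/-- **Uniformly bounded partial sums**: for `d ≥ 3`, `L ≥ 1`,
`Σ_{n<M} D^{*n}(x) ≤ (2π)^{-d} ∫_{[-π,π]^d} N_L/ε(k) dk < ∞`, by the Fourier representation,
`|Σ_{n<M} D̂ⁿ| ≤ 2/(1 - D̂) ≤ N_L/ε` off `k = 0`, and the integrability of `1/ε` in `d ≥ 3`
(`integrable_indicator_inv_dispersion`). [cite: LiuSlade2026, §1.2.1 ((1.6)–(1.8): S_1 for d > 2)] -/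
theorem sum_range_convPow_le (hd : 3 ≤ d) (hL : 1 ≤ L) (x : Site d) (M : ℕ) :
    ∑ n ∈ Finset.range M, convPow (soStep d L) n x ≤
      ((2 * π) ^ d)⁻¹ * ∫ k in cube d, soCount d L / dispersion k := by
  have hd1 : 1 ≤ d := by omega
  have hN : (0 : ℝ) < soCount d L := by exact_mod_cast soCount_pos hd1 hL
  have hπ : (0 : ℝ) < ((2 * π) ^ d)⁻¹ := by positivity
  -- the partial sum as one integral
  set F : (Fin d → ℝ) → ℝ := fun k => (∑ n ∈ Finset.range M, soSymbol d L k ^ n) * Real.cos (kdot k x)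
    with hF
  have hFint : IntegrableOn F (cube d) volume := by
    refine ContinuousOn.integrableOn_compact (isCompact_univ_pi fun _ => isCompact_Icc) ?_
    exact ((continuous_finsetSum _ fun n _ => continuous_soSymbol.pow n).mul
      (Real.continuous_cos.comp (continuous_kdot_left x))).continuousOn
  have hsum : ∑ n ∈ Finset.range M, convPow (soStep d L) n x = ((2 * π) ^ d)⁻¹ * ∫ k in cube d, F k := by
    simp_rw [convPow_eq_integral, ← Finset.mul_sum]
    congr 1
    rw [← integral_finsetSum _ fun n _ => integrableOn_soSymbol_pow_mul_cos n x]
    refine integral_congr_ae (ae_of_all _ fun k => ?_)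
    simp only [hF, Finset.sum_mul]
  rw [hsum]
  refine mul_le_mul_of_nonneg_left ?_ hπ.le
  -- `∫ F ≤ ∫ |F| ≤ ∫ N/ε`
  have hG : IntegrableOn (fun k : Fin d → ℝ => soCount d L / dispersion k) (cube d) volume := by
    have h := (integrable_indicator_iff (measurableSet_brillouin d)).1
      (integrable_indicator_inv_dispersion (d := d) hd)
    have h' : IntegrableOn (fun k : Fin d → ℝ => (soCount d L : ℝ) * (1 / dispersion k)) (cube d) volume :=
      h.const_mul _
    refine h'.congr_fun (fun k _ => ?_) (measurableSet_brillouin d)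
    show (soCount d L : ℝ) * (1 / dispersion k) = soCount d L / dispersion k
    rw [mul_one_div]
  haveI : Nonempty (Fin d) := ⟨⟨0, by omega⟩⟩
  have hae0 : ∀ᵐ k ∂(volume.restrict (cube d)), k ≠ (0 : Fin d → ℝ) := by
    rw [ae_iff]
    have hsub : {k : Fin d → ℝ | ¬k ≠ 0} ⊆ {0} := fun k hk => by simpa using hk
    have hle : (volume.restrict (cube d)) {k : Fin d → ℝ | ¬k ≠ 0} ≤ volume ({0} : Set (Fin d → ℝ)) :=
      (measure_mono hsub).trans (Measure.restrict_apply_le _ _)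
    exact le_antisymm (hle.trans (measure_singleton _).le) bot_le
  have hbound : ∀ᵐ k ∂(volume.restrict (cube d)), ‖F k‖ ≤ soCount d L / dispersion k := by
    filter_upwards [hae0, self_mem_ae_restrict (measurableSet_brillouin d)] with k hk0 hk
    have hlt := soSymbol_lt_one hd1 hL hk hk0
    have hge : -1 ≤ soSymbol d L k := (abs_le.1 (abs_soSymbol_le_one k)).1
    have hε : 0 < dispersion k := dispersion_pos_of_mem_brillouin hk hk0
    have h1 : 0 < 1 - soSymbol d L k := by linarith
    rw [Real.norm_eq_abs, hF]
    simp only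
    rw [abs_mul]
    calc |∑ n ∈ Finset.range M, soSymbol d L k ^ n| * |Real.cos (kdot k x)|
        ≤ 2 / (1 - soSymbol d L k) * 1 :=
          mul_le_mul (abs_geom_sum_le hge hlt M) (Real.abs_cos_le_one _) (abs_nonneg _)
            (div_nonneg zero_le_two h1.le)
      _ = 2 / (1 - soSymbol d L k) := mul_one _
      _ ≤ 2 / (2 / soCount d L * dispersion k) :=
          div_le_div_of_nonneg_left zero_le_two (by positivity)
            (mul_dispersion_le_one_sub_soSymbol hd1 hL k)
      _ = soCount d L / dispersion k := by field_simp
  calc ∫ k in cube d, F k ≤ ‖∫ k in cube d, F k‖ := Real.le_norm_self _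
    _ ≤ ∫ k in cube d, ‖F k‖ := norm_integral_le_integral_norm _
    _ ≤ ∫ k in cube d, soCount d L / dispersion k := integral_mono_ae hFint.norm hG hbound

/-- **Transience of the spread-out walk, `d ≥ 3`, `L ≥ 1`**: `Σ_n D^{*n}(x) < ∞` for every `x`
(nonnegative terms with uniformly bounded partial sums). [cite: LiuSlade2026, §1.2.1 ((1.6)–(1.8): S_1 for d > 2)] [cite: Sakai2007, §1.2, (1.19) and the sentence after it] -/
theorem summable_convPow (hd : 3 ≤ d) (hL : 1 ≤ L) (x : Site d) :
    Summable fun n : ℕ => convPow (soStep d L) n x :=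
  summable_of_sum_range_le (fun n => convPow_nonneg n x) fun M => sum_range_convPow_le hd hL x M


end Transience

/-! ## Discharges -/

/-- **Discharge of the named fact `soWalk_transient`** (transience of the spread-out walk,
`d > 2`, `L ≥ 1`). [cite: LiuSlade2026, §1.2.1 ((1.6)–(1.8): S_1 for d > 2)] -/
theorem soWalk_transient_holds : soWalk_transient := fun _ _ hd hL x =>
  summable_convPow (by omega) hL x

/-- **Discharge of the named fact `spreadOutTwoPoint_le_soGreen`** (the random-walk bound
`G_β ≤ S_τ`, `τ ≤ 1`, Sakai 2007, §4.1, footnote to (4.2)) — now unconditional.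
[cite: Sakai2007, §4.1, footnote to (4.2) (random-walk bound)] -/
theorem spreadOutTwoPoint_le_soGreen_holds : spreadOutTwoPoint_le_soGreen :=
  spreadOutTwoPoint_le_soGreen_of_transient soWalk_transient_holds

/-- **Liu–Slade's Assumption 1.3 holds for the spread-out Ising model** (`d > 2`, `L ≥ 1`),
unconditionally. [cite: LiuSlade2026, Assumption 1.3] [cite: Sakai2007, §1.1, §3.1 and §4.1] -/
theorem lsAssumptionG_isingFamily_holds (hd : 2 < d) (hL : 1 ≤ L) :
    LSAssumptionG d L (isingFamily d L) (isingZc d L) :=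
  lsAssumptionG_isingFamily' hd hL spreadOutTwoPoint_le_soGreen_holds

/-- **Sakai's Theorem 1.3 (spread-out) from three named facts**: Liu–Slade's Prop. 1.2
(`LiuSlade2026_prop12_greenBound`) and Thm. 1.7 (`LiuSlade2026_thm17`) — pure analysis — and
Sakai's lace expansion with diagrammatic bounds (`Sakai2007_isingAssumptionH`); every property of
the model that the deconvolution asks for (Assumption 1.3) being a theorem of the tree.
[cite: Sakai2007, Theorem 1.3 (SO model)] [cite: LiuSlade2026, Theorem 1.7] -/
theorem Sakai2007_thm13_spreadOut_of_three_facts (h0 : LiuSlade2026_prop12_greenBound)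
    (h1 : LiuSlade2026_thm17) (h2 : Sakai2007_isingAssumptionH) : Sakai2007_thm13_spreadOut :=
  Sakai2007_thm13_spreadOut_of_LS'' h0 h1 h2 soWalk_transient_holds

/-- **Sakai's Theorem 1.3 (spread-out) from the corrected Theorem 1.7 and the transience fact**:
as `Sakai2007_thm13_spreadOut_of_LS''`, with `LiuSlade2026_thm1_7` (the corrected transcription,
`LaceExpansionIsingDeconvolution.lean`, Part G) in place of the misstated `LiuSlade2026_thm17`.
[cite: LiuSlade2026, Assumption 1.3 and Theorem 1.7] [cite: Sakai2007, Theorem 1.3 (SO model)] -/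
theorem Sakai2007_thm13_spreadOut_of_thm1_7'' (h0 : LiuSlade2026_prop12_greenBound)
    (h1 : LiuSlade2026_thm1_7) (h2 : Sakai2007_isingAssumptionH) (hT : soWalk_transient) :
    Sakai2007_thm13_spreadOut :=
  Sakai2007_thm13_spreadOut_of_thm1_7' h0 h1 h2 (spreadOutTwoPoint_le_soGreen_of_transient hT)

/-- **Sakai's Theorem 1.3 (spread-out) from three named facts, corrected trust base**:
Liu–Slade's Prop. 1.2 (`LiuSlade2026_prop12_greenBound`) and Thm. 1.7 in its corrected
transcription (`LiuSlade2026_thm1_7`) — pure analysis — and Sakai's lace expansion with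
diagrammatic bounds (`Sakai2007_isingAssumptionH`); transience and every clause of
Assumption 1.3 being theorems of the tree. Supersedes `Sakai2007_thm13_spreadOut_of_three_facts`,
whose hypothesis `LiuSlade2026_thm17` is misstated. [cite: Sakai2007, Theorem 1.3 (SO model)] [cite: LiuSlade2026, Theorem 1.7] -/
theorem Sakai2007_thm13_spreadOut_of_three_facts' (h0 : LiuSlade2026_prop12_greenBound)
    (h1 : LiuSlade2026_thm1_7) (h2 : Sakai2007_isingAssumptionH) : Sakai2007_thm13_spreadOut :=
  Sakai2007_thm13_spreadOut_of_thm1_7'' h0 h1 h2 soWalk_transient_holds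

end Literature.Barriers.CriticalPhenomena.SpreadOutIsing

namespace Literature.Barriers.CriticalPhenomena

/-- **The barrier `LaceExpansionIsingAboveFour` from five named facts** — the present trust base of
the Ising entry of the catalogue: Aizenman's bubble bound `B(β_c) < ∞ ⇒ χ_β ≤ C(β_c - β)⁻¹` for the
nearest-neighbour and for the spread-out model (Aizenman 1982 / Aizenman–Graham 1983, as quoted by
Sakai 2007, §1.1), Liu–Slade's Proposition 1.2 and Theorem 1.7 (pure analysis), and Sakai's lace
expansion with diagrammatic bounds (Prop. 1.1, Prop. 3.1, §3.1 of Sakai 2007; Sakai 2022);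
everything else in the three conjuncts is proved in the tree (`…Reduction.lean`,
`…Deconvolution.lean`, this file). [cite: Sakai2007, §1.1 and Theorem 1.3] [cite: LiuSlade2026, Theorem 1.7] -/
theorem LaceExpansionIsingAboveFour_of_five_facts (h₁ : NNIsing.bubble_susceptibility_upper)
    (h₂ : SpreadOutIsing.bubble_susceptibility_upper)
    (h₃ : SpreadOutIsing.LiuSlade2026_prop12_greenBound) (h₄ : SpreadOutIsing.LiuSlade2026_thm17)
    (h₅ : SpreadOutIsing.Sakai2007_isingAssumptionH) : LaceExpansionIsingAboveFour :=
  LaceExpansionIsingAboveFour_of_facts h₁ h₂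
    (SpreadOutIsing.Sakai2007_thm13_spreadOut_of_three_facts h₃ h₄ h₅)

/-- **The barrier `LaceExpansionIsingAboveFour` from five named facts, corrected trust base**:
Aizenman's bubble bound for the nearest-neighbour and for the spread-out model, Liu–Slade's
Proposition 1.2 and Theorem 1.7 — the latter in its corrected transcription
`SpreadOutIsing.LiuSlade2026_thm1_7` (`LaceExpansionIsingDeconvolution.lean`, Part G) — and Sakai's
lace expansion with diagrammatic bounds. Supersedes `LaceExpansionIsingAboveFour_of_five_facts`,
whose hypothesis `LiuSlade2026_thm17` is misstated (false as stated), so that the barrier's live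
trust base no longer contains it. [cite: Sakai2007, §1.1 and Theorem 1.3] [cite: LiuSlade2026, Theorem 1.7] -/
theorem LaceExpansionIsingAboveFour_of_five_facts' (h₁ : NNIsing.bubble_susceptibility_upper)
    (h₂ : SpreadOutIsing.bubble_susceptibility_upper)
    (h₃ : SpreadOutIsing.LiuSlade2026_prop12_greenBound) (h₄ : SpreadOutIsing.LiuSlade2026_thm1_7)
    (h₅ : SpreadOutIsing.Sakai2007_isingAssumptionH) : LaceExpansionIsingAboveFour :=
  LaceExpansionIsingAboveFour_of_facts h₁ h₂
    (SpreadOutIsing.Sakai2007_thm13_spreadOut_of_three_facts' h₃ h₄ h₅)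

end Literature.Barriers.CriticalPhenomena

end
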